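import Mathlib
import Literature.NumberTheory.LFunctions.Zhang2022.KnifeEdgeOverhangRankOne
import HarnessLib

/-!
# Sampling an in-class profile along `m ↦ log m / log P`: sup and discrete-variation bounds
# (the profile constants `S_G = V_G = ∫₀¹‖g′‖` of the `χ`-window lemma, Zhang (2022) §7–§8)

Topic `Literature/NumberTheory/LFunctions/Zhang2022` (Landau–Siegel audit tree; verdict-neutral).
Y. Zhang, *Discrete mean estimates and the Landau–Siegel zero*, arXiv:2211.02515v1 (2022)
[Zhang2022LandauSiegel] — **an unrefereed manuscript under adjudication; nothing here asserts or
denies its Theorems 1–2.** Cell landau-siegel, instance sheet `ls-ref-1/CHIWINDOW-INSTANCE-v1.md`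
move (M2), critic read ls-knife-crit-1 2026-08-27T18:22:17Z: the weights of the cell datum
`longPsiData χ b g f` are the SAMPLES `G(m) = g(log m / log P)` of an in-class profile `g`
(`KnifeEdge.InClassPiece g g′`: `H¹` on `[0,1]`, `≡ 0` on `[1,∞)`), and the `χ`-window lemma
`WindowHyperbola.norm_window_head_chi_conv_coprime_le` wants, locally on `[1, M]`, a sup bound
`hGs` and a discrete-variation bound `hGv` for them. This file proves both, THEOREMS ONLY, with the
single constant `V(g) = ∫₀¹ ‖g′‖` (`≤ ‖g′‖_{L²(0,1)}` by `sq_integral_norm_le_unit`):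

* `InClassPiece.norm_sub_le_integral_norm`: `‖g y − g x‖ ≤ ∫ₓʸ ‖g′‖` for `0 ≤ x ≤ y ≤ 1` (FTC,
  `IsH1OnUnitInterval.eq_add_integral`);
* `InClassPiece.norm_le_tv`: `‖g y‖ ≤ V(g)` for every `y ≥ 0` (uses `g(1) = 0`);
* `InClassPiece.norm_sample_le`: `‖g(log m / L)‖ ≤ V(g)` for every `m : ℕ` and `L > 0`;
* `InClassPiece.sum_norm_sample_sub_le`: for all `N′ M′`,
  `Σ_{m ∈ Ioo N′ M′} ‖g(log m/L) − g(log (m+1)/L)‖ ≤ V(g)` — telescoping over the increasing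
  clamped samples `s_m = min(log m / L, 1)`; the samples past `1` sit where `g ≡ 0` and `g` is
  left-continuous at `1` with `g(1) = 0`, so there is no jump term (the sampled range needs no
  separate hypothesis);
* `InClassPiece.sample_hyps`: the two bounds packaged in the exact hypothesis shapes `hGs`, `hGv`
  of `WindowHyperbola.norm_window_head_chi_conv_coprime_le` (for every `M`).

No zero-free region, no Siegel-type hypothesis, no `t₀/ε₁` input; pure real analysis on `[0,1]`.

## References

* Y. Zhang, arXiv:2211.02515v1 (2022), §7 Prop. 7.1 (7.2), §8 (8.8), Lemma 8.1.
  [cite: Zhang2022LandauSiegel, §7 Prop. 7.1 (7.2); §8 (8.8)]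
* H. L. Montgomery, R. C. Vaughan, *Multiplicative Number Theory I*, CUP 2007, §1.3 Thm. 1.3
  (Abel summation / bounded variation weights). [cite: MontgomeryVaughan2007, §1.3 Thm. 1.3]
-/

noncomputable section

open Finset MeasureTheory intervalIntegral

namespace Literature.NumberTheory.LFunctions.Zhang2022.KnifeEdge.InClassPiece

open Literature.NumberTheory.LFunctions.Zhang2022

variable {g g' : ℝ → ℂ}

/-! ### §A. FTC differences on `[0,1]` -/

/-- An in-class piece is `H¹` on `[0,1]`. [cite: Zhang2022LandauSiegel, §7 Prop. 7.1 (7.2)] -/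
theorem isH1 (hg : InClassPiece g g') : IsH1OnUnitInterval g g' := hg.kinked.isH1

/-- `g′` is interval integrable on every `[x, y] ⊆ [0, 1]`. [folklore] -/
private theorem intervalIntegrable_deriv_Icc (hg : InClassPiece g g') {x y : ℝ} (hx : 0 ≤ x)
    (hxy : x ≤ y) (hy : y ≤ 1) : IntervalIntegrable g' volume x y :=
  (hg.isH1.intervalIntegrable).mono_set (by
    rw [Set.uIcc_of_le hxy, Set.uIcc_of_le zero_le_one]
    exact Set.Icc_subset_Icc hx hy)

/-- **FTC difference**: for `0 ≤ x ≤ y ≤ 1`, `g y − g x = ∫ₓʸ g′`.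
[cite: Zhang2022LandauSiegel, §7 Prop. 7.1 (7.2)] -/
theorem sub_eq_integral (hg : InClassPiece g g') {x y : ℝ} (hx : 0 ≤ x) (hxy : x ≤ y)
    (hy : y ≤ 1) : g y - g x = ∫ t in x..y, g' t := by
  have h1 := hg.isH1
  have ey := h1.eq_add_integral y ⟨hx.trans hxy, hy⟩
  have ex := h1.eq_add_integral x ⟨hx, hxy.trans hy⟩
  have hiy : IntervalIntegrable g' volume 0 y :=
    intervalIntegrable_mono_unit h1.intervalIntegrable ⟨hx.trans hxy, hy⟩
  have hix : IntervalIntegrable g' volume 0 x :=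
    intervalIntegrable_mono_unit h1.intervalIntegrable ⟨hx, hxy.trans hy⟩
  rw [ey, ex, add_sub_add_left_eq_sub, integral_interval_sub_left hiy hix]

/-- **`‖g y − g x‖ ≤ ∫ₓʸ ‖g′‖`** for `0 ≤ x ≤ y ≤ 1`. [cite: MontgomeryVaughan2007, §1.3 Thm. 1.3] -/
theorem norm_sub_le_integral_norm (hg : InClassPiece g g') {x y : ℝ} (hx : 0 ≤ x) (hxy : x ≤ y)
    (hy : y ≤ 1) : ‖g y - g x‖ ≤ ∫ t in x..y, ‖g' t‖ := by
  rw [hg.sub_eq_integral hx hxy hy]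
  exact intervalIntegral.norm_integral_le_integral_norm hxy

/-- Monotonicity of `∫ ‖g′‖` in the interval: `[x, y] ⊆ [0, 1] ⇒ ∫ₓʸ‖g′‖ ≤ ∫₀¹‖g′‖`.
[cite: MontgomeryVaughan2007, §1.3 Thm. 1.3] -/
theorem integral_norm_mono (hg : InClassPiece g g') {x y : ℝ} (hx : 0 ≤ x) (hxy : x ≤ y)
    (hy : y ≤ 1) : ∫ t in x..y, ‖g' t‖ ≤ ∫ t in (0:ℝ)..1, ‖g' t‖ :=
  intervalIntegral.integral_mono_interval hx hxy hy
    (Filter.Eventually.of_forall fun _ => norm_nonneg _) hg.isH1.intervalIntegrable.norm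

/-- `0 ≤ ∫ₓʸ ‖g′‖` for `x ≤ y`. [cite: MontgomeryVaughan2007, §1.3 Thm. 1.3] -/
theorem integral_norm_nonneg {x y : ℝ} (hxy : x ≤ y) : 0 ≤ ∫ t in x..y, ‖g' t‖ :=
  intervalIntegral.integral_nonneg hxy fun _ _ => norm_nonneg _

/-! ### §B. The sup bound -/

/-- **Sup bound**: `‖g y‖ ≤ ∫₀¹ ‖g′‖` for every `y ≥ 0` (for `y ≤ 1`: `g y = −∫_y¹ g′` since
`g 1 = 0`; for `y ≥ 1`: `g y = 0`). [cite: Zhang2022LandauSiegel, §7 Prop. 7.1 (7.2)] -/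
theorem norm_le_tv (hg : InClassPiece g g') {y : ℝ} (hy : 0 ≤ y) :
    ‖g y‖ ≤ ∫ t in (0:ℝ)..1, ‖g' t‖ := by
  rcases le_or_gt 1 y with h1 | h1
  · rw [hg.vanish y h1, norm_zero]
    exact integral_norm_nonneg zero_le_one
  · have h := hg.norm_sub_le_integral_norm hy h1.le le_rfl
    rw [hg.vanish 1 le_rfl, zero_sub, norm_neg] at h
    exact h.trans (hg.integral_norm_mono hy h1.le le_rfl)

/-- **Sup bound for the samples**: `‖g(log m / L)‖ ≤ ∫₀¹ ‖g′‖` for every `m : ℕ` and `L > 0`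
(`log m ≥ 0` for naturals, `Real.log 0 = 0`). [cite: Zhang2022LandauSiegel, §8 (8.8)] -/
theorem norm_sample_le (hg : InClassPiece g g') {L : ℝ} (hL : 0 < L) (m : ℕ) :
    ‖g (Real.log m / L)‖ ≤ ∫ t in (0:ℝ)..1, ‖g' t‖ :=
  hg.norm_le_tv (div_nonneg (Real.log_natCast_nonneg m) hL.le)

/-! ### §C. The discrete-variation bound -/

/-- The value of `g` at a sample equals its value at the CLAMPED sample `min(t, 1)` (both vanish
past `1`). [cite: Zhang2022LandauSiegel, §7 Prop. 7.1 (7.2)] -/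
theorem apply_eq_apply_min (hg : InClassPiece g g') (t : ℝ) : g t = g (min t 1) := by
  rcases le_or_gt t 1 with h | h
  · rw [min_eq_left h]
  · rw [min_eq_right h.le, hg.vanish t h.le, hg.vanish 1 le_rfl]

/-- One step of the telescope: for `0 ≤ t ≤ t'`,
`‖g t − g t'‖ ≤ ∫_{min(t,1)}^{min(t',1)} ‖g′‖`. [cite: MontgomeryVaughan2007, §1.3 Thm. 1.3] -/
theorem norm_sub_le_integral_clamp (hg : InClassPiece g g') {t t' : ℝ} (ht : 0 ≤ t)
    (htt' : t ≤ t') : ‖g t - g t'‖ ≤ ∫ s in (min t 1)..(min t' 1), ‖g' s‖ := by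
  rw [hg.apply_eq_apply_min t, hg.apply_eq_apply_min t', ← norm_neg, neg_sub]
  exact hg.norm_sub_le_integral_norm (le_min ht zero_le_one) (min_le_min_right 1 htt')
    (min_le_right _ _)

/-- **Discrete variation of the samples**: for every `N′ M′` and `L > 0`,
`Σ_{m ∈ Ioo N′ M′} ‖g(log m / L) − g(log(m+1) / L)‖ ≤ ∫₀¹ ‖g′‖` — the clamped samples
`s_m = min(log m / L, 1)` increase with `m`, the steps telescope to `∫_{s_{N′+1}}^{s_{M′}} ‖g′‖`.
[cite: Zhang2022LandauSiegel, §8 (8.8)] [cite: MontgomeryVaughan2007, §1.3 Thm. 1.3] -/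
theorem sum_norm_sample_sub_le (hg : InClassPiece g g') {L : ℝ} (hL : 0 < L) (N' M' : ℕ) :
    ∑ m ∈ Ioo N' M', ‖g (Real.log m / L) - g (Real.log ((m + 1 : ℕ) : ℝ) / L)‖ ≤
      ∫ t in (0:ℝ)..1, ‖g' t‖ := by
  -- the clamped samples
  set s : ℕ → ℝ := fun m => min (Real.log m / L) 1 with hs
  have hs0 : ∀ m, 0 ≤ s m := fun m =>
    le_min (div_nonneg (Real.log_natCast_nonneg m) hL.le) zero_le_one
  have hs1 : ∀ m, s m ≤ 1 := fun m => min_le_right _ _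
  have hlogmono : ∀ {m n : ℕ}, m ≤ n → 0 < m → Real.log m / L ≤ Real.log n / L :=
    fun {m n} hmn hm => div_le_div_of_nonneg_right
      (Real.log_le_log (by exact_mod_cast hm) (by exact_mod_cast hmn)) hL.le
  have hsmono : ∀ {m n : ℕ}, m ≤ n → 0 < m → s m ≤ s n := fun {m n} hmn hm =>
    min_le_min_right 1 (hlogmono hmn hm)
  -- each step is bounded by the integral over [s m, s (m+1)]
  have hstep : ∀ m ∈ Finset.Ioo N' M', ‖g (Real.log m / L) - g (Real.log ((m + 1 : ℕ) : ℝ) / L)‖ ≤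
      ∫ t in (s m)..(s (m + 1)), ‖g' t‖ := fun m hm => by
    have hm0 : 0 < m := by have := (Finset.mem_Ioo.mp hm).1; omega
    exact hg.norm_sub_le_integral_clamp (div_nonneg (Real.log_natCast_nonneg m) hL.le)
      (hlogmono (Nat.le_succ m) hm0)
  rcases le_or_gt M' (N' + 1) with hMN | hMN
  · -- empty range
    have : Finset.Ioo N' M' = ∅ := by
      ext m; simp only [Finset.mem_Ioo, Finset.notMem_empty, iff_false]; omega
    rw [this, Finset.sum_empty]
    exact integral_norm_nonneg zero_le_one
  · calc ∑ m ∈ Ioo N' M', ‖g (Real.log m / L) - g (Real.log ((m + 1 : ℕ) : ℝ) / L)‖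
        ≤ ∑ m ∈ Ioo N' M', ∫ t in (s m)..(s (m + 1)), ‖g' t‖ := Finset.sum_le_sum hstep
      _ = ∑ m ∈ Ico (N' + 1) M', ∫ t in (s m)..(s (m + 1)), ‖g' t‖ := by
          rw [← Finset.Ico_add_one_left_eq_Ioo]
      _ = ∫ t in (s (N' + 1))..(s M'), ‖g' t‖ := by
          refine intervalIntegral.sum_integral_adjacent_intervals_Ico hMN.le fun k hk => ?_
          have hk0 : 0 < k := by have := (Set.mem_Ico.mp hk).1; omega
          exact ((intervalIntegrable_deriv_Icc hg (hs0 k) (hsmono (Nat.le_succ k) hk0)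
            (hs1 (k + 1))).norm)
      _ ≤ ∫ t in (0:ℝ)..1, ‖g' t‖ :=
          hg.integral_norm_mono (hs0 _) (hsmono hMN.le (Nat.succ_pos N')) (hs1 _)

/-! ### §D. Packaged in the hypothesis shapes of the `χ`-window lemma -/

/-- **The profile constants of the `χ`-window lemma**: with `G m := g(log m / L)`, `L > 0`, and
`V := ∫₀¹ ‖g′‖`, for every `M`: `∀ n ≤ M, ‖G n‖ ≤ V` and
`∀ N′ M′ ≤ M, Σ_{n ∈ Ioo N′ M′} ‖G n − G (n+1)‖ ≤ V` — the hypotheses `hGs`, `hGv` of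
`WindowHyperbola.norm_window_head_chi_conv_coprime_le` with `S_G = V_G = V` (both hold for all
`M`; the restriction is kept only to match the shapes).
[cite: Zhang2022LandauSiegel, §8 (8.8), Lemma 8.1] -/
theorem sample_hyps (hg : InClassPiece g g') {L : ℝ} (hL : 0 < L) (M : ℕ) :
    (∀ n : ℕ, n ≤ M → ‖(fun m : ℕ => g (Real.log m / L)) n‖ ≤ ∫ t in (0:ℝ)..1, ‖g' t‖) ∧
    (∀ N' M' : ℕ, M' ≤ M →
      ∑ n ∈ Ioo N' M', ‖(fun m : ℕ => g (Real.log m / L)) n -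
        (fun m : ℕ => g (Real.log m / L)) (n + 1)‖ ≤ ∫ t in (0:ℝ)..1, ‖g' t‖) :=
  ⟨fun n _ => hg.norm_sample_le hL n, fun N' M' _ => hg.sum_norm_sample_sub_le hL N' M'⟩

/-- `0 ≤ V(g) = ∫₀¹ ‖g′‖` (the sign conditions `hSG`, `hSF` of the `χ`-window lemma).
[cite: Zhang2022LandauSiegel, §8 (8.8), Lemma 8.1] -/
theorem tv_nonneg : 0 ≤ ∫ t in (0:ℝ)..1, ‖g' t‖ := integral_norm_nonneg zero_le_one

/-- `V(g)² ≤ ∫₀¹ ‖g′‖²` (Cauchy–Schwarz on the unit interval: the constant is controlled by the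
`H¹` seminorm). [cite: Zhang2022LandauSiegel, §7 Prop. 7.1 (7.2)] -/
theorem tv_sq_le (hg : InClassPiece g g') :
    (∫ t in (0:ℝ)..1, ‖g' t‖) ^ 2 ≤ ∫ t in (0:ℝ)..1, ‖g' t‖ ^ 2 :=
  sq_integral_norm_le_unit hg.isH1.intervalIntegrable hg.isH1.intervalIntegrable_sq

end Literature.NumberTheory.LFunctions.Zhang2022.KnifeEdge.InClassPiece

end
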